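import Literature.AlgebraicGeometry.Crystalline.BlochEsnaultKerzLifting
import Literature.AlgebraicGeometry.Deformation.VectorBundleExtensionObstruction
import Literature.AlgebraicGeometry.Motives.HodgeSheaves
import Literature.AlgebraicGeometry.Motives.AbelianVariety

/-!
# Sketch — crux-ideate round 1, ideator 2, crux `PadicPridhamSemiregularity` (stmt-HodgeConjecture-13815)

First lemmas of the three crux idea cards
`Ideas/fourier-rotation.md` (A), `Ideas/crystalline-abel-jacobi.md` (B), `Ideas/thickening-torsor.md` (C),
stated over existing declarations only (real carriers: `obstructionGroup` = Mathlib `Ext` in `X.Modules`,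
`hodgeCohomology X a b = Hᵇ(X, Ωᵃ)`, the `WittScheme` tower, `LiftsAlong`, `CrystallineRealization`).
The crystalline Buchweitz–Flenner maps `σ_q` have no constructed carrier in the tree; as in
`HodgeTheory/SemiregularityMap` they enter as DATA (`AtiyahTracePackage`), and every statement below
that mentions them is a `Prop`-valued predicate of that data (named-fact pattern of
`Motives/CrystallineRealization`), never a closed theorem. Nothing here is filed; provers never see this file.
-/

noncomputable section

open CategoryTheory AlgebraicGeometry
open Literature.AlgebraicGeometry.Motives Literature.AlgebraicGeometry.Motives.WittScheme
open Literature.AlgebraicGeometry.Crystalline Literature.AlgebraicGeometry.Deformation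

universe u

set_option linter.dupNamespace false

namespace Summit.HodgeConjecture.HodgeConjecture.Cruxes.PadicPridhamSemiregularity.Ideas

/-! ## Common vocabulary -/

/-- A crystalline Buchweitz–Flenner package on REAL carriers: for every `k`-scheme `X`, every
`𝒪_X`-module `E` and every `q`, an additive map
`σ_q : Ext²(E, E ⊗ 𝒪_X) → H^{q+2}(X, Ω^q_{X/k})` (intended: `tr(At(E)^q ∘ −)/q!`, `q < p`).
Source and target are the tree's real groups; only the map is data. -/
structure AtiyahTracePackage (k : Type u) [CommRing k] where
  /-- `σ_q` on `Ext²(E, E ⊗ 𝒪_X)`. -/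
  sigma : ∀ (X : SchemeOver k) (E : X.left.Modules) (q : ℕ),
    obstructionGroup 2 E (structureSheafModule X.left) →+ hodgeCohomology X q (q + 2)

/-- `E` is p-ADICALLY SEMIREGULAR for the package `Θ`: `⊕_{q<p} σ_q` is injective on `Ext²(E, E ⊗ 𝒪)`. -/
def AtiyahTracePackage.IsPadicSemiregular {k : Type u} [CommRing k] (Θ : AtiyahTracePackage k)
    (p : ℕ) (X : SchemeOver k) (E : X.left.Modules) : Prop :=
  ∀ x : obstructionGroup 2 E (structureSheafModule X.left), (∀ q, q < p → Θ.sigma X E q x = 0) → x = 0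

/-- TORSION-FREE HODGE COHOMOLOGY of a model `𝒳/W` in ALL bidegrees (typable now that
`Motives/HodgeSheaves` has landed): `Hᵇ(𝒳, Ωᵃ_{𝒳/W})` has no `p`-torsion for all `a, b`. -/
def HodgeTorsionFree (p : ℕ) {O : Type u} [CommRing O] (𝒳 : SchemeOver O) : Prop :=
  ∀ (a b : ℕ) (x : hodgeCohomology 𝒳 a b), (p : ℤ) • x = 0 → x = 0

section Witt

variable {p : ℕ} [Fact p.Prime] {k : Type u} [Field k] [CharP k p] [PerfectRing k p]

/-- STEP LIFTING on the `p`-adic tower of `𝒳` (the level-wise consequence of P1b♮ that all three cards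
aim at): every finite locally free `F` on `X_{n+1}` restricting to a `Θ`-semiregular `E₁` with the BEK
Hodge condition lifts along `X_{n+1} ⟶ X_{n+2}`. -/
def StepLifting (C : CrystallineRealization p k) (Θ : AtiyahTracePackage k)
    (𝒳 : SchemeOver (WittVector p k)) : Prop :=
  ∀ (E₁ : (specialFibre 𝒳).left.Modules), IsFiniteLocallyFree E₁ →
    Θ.IsPadicSemiregular p (specialFibre 𝒳) E₁ → C.HodgeCondition 𝒳 E₁ →
    ∀ (n : ℕ) (F : (thickening 𝒳 (n + 1)).left.Modules), IsFiniteLocallyFree F →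
      Nonempty ((Scheme.Modules.pullback (specialFibreToThickening 𝒳 n)).obj F ≅ E₁) →
      LiftsAlong (thickeningMap 𝒳 (Nat.le_succ (n + 1))) F

/-! ## Card B — crystalline Abel–Jacobi (Pridham over `W`, no Goodwillie) -/

/-- Card B, OUTPUT predicate: on every Hodge-torsion-free smooth projective model of relative dimension
`d` with `d + 2 ≤ p`, step lifting holds (what `ξ(o(E_n)) =` "obstruction to lifting the filtered
crystalline `ch_r`" gives, Pridham Cor. 2.23 shape). -/
def CrystallineAbelJacobiLifting (C : CrystallineRealization p k) (Θ : AtiyahTracePackage k) : Prop :=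
  ∀ ⦃d : ℕ⦄ ⦃𝒳 : SchemeOver (WittVector p k)⦄, IsSmoothProperModel d 𝒳 → IsProjectiveOverRing 𝒳 →
    d + 2 ≤ p → HodgeTorsionFree p 𝒳 → StepLifting C Θ 𝒳

/-- Card B, FIRST LEMMA (tower assembly, `K₀`-free — the bookkeeping that makes the typed crux
`FormalLiftingFromClassLifting` redundant once step lifting is known): a level-0 lift plus step
lifting at every level gives `LiftsFormally`. Real statement; proof = induction + choice. -/
def TowerAssembly (𝒳 : SchemeOver (WittVector p k)) (E₁ : (specialFibre 𝒳).left.Modules) : Prop :=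
  LiftsToThickening 𝒳 E₁ 0 →
    (∀ (n : ℕ) (F : (thickening 𝒳 (n + 1)).left.Modules), IsFiniteLocallyFree F →
      Nonempty ((Scheme.Modules.pullback (specialFibreToThickening 𝒳 n)).obj F ≅ E₁) →
      LiftsAlong (thickeningMap 𝒳 (Nat.le_succ (n + 1))) F) →
    LiftsFormally 𝒳 E₁

/-- Card B, the implication the card claims for the CLASSICAL `(C, Θ)` once the crystalline Abel–Jacobi
map is built: step lifting + tower assembly ⇒ the repaired P1 (`LiftsFormally`) with `p ≥ d + 2` only. -/
def CrystallineAbelJacobiFirstLemma (C : CrystallineRealization p k) (Θ : AtiyahTracePackage k) : Prop :=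
  CrystallineAbelJacobiLifting C Θ →
    ∀ ⦃d : ℕ⦄ ⦃𝒳 : SchemeOver (WittVector p k)⦄, IsSmoothProperModel d 𝒳 → IsProjectiveOverRing 𝒳 →
      d + 2 ≤ p → HodgeTorsionFree p 𝒳 → (∀ E₁, TowerAssembly 𝒳 E₁) →
      ∀ (E₁ : (specialFibre 𝒳).left.Modules), IsFiniteLocallyFree E₁ →
        Θ.IsPadicSemiregular p (specialFibre 𝒳) E₁ → C.HodgeCondition 𝒳 E₁ →
        LiftsToThickening 𝒳 E₁ 0 → LiftsFormally 𝒳 E₁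

/-- The logic of Card B's first lemma is formal (the content is in `CrystallineAbelJacobiLifting`). -/
theorem crystallineAbelJacobiFirstLemma_holds (C : CrystallineRealization p k) (Θ : AtiyahTracePackage k) :
    CrystallineAbelJacobiFirstLemma C Θ := by
  intro hAJ d 𝒳 h𝒳 hproj hp htf hT E₁ hE hsr hH h0
  exact hT E₁ h0 (fun n F hF hres => hAJ h𝒳 hproj hp htf E₁ hE hsr hH n F hF hres)

/-! ## Card A — Fourier–Mukai rotation on abelian threefold models -/

/-- `𝒳/W` is an ABELIAN THREEFOLD MODEL: smooth projective model of relative dimension `3` whose special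
fibre underlies an abelian variety (then `𝒳` is an abelian scheme: a `W`-section exists by Hensel, and a
smooth proper deformation of an abelian variety with a section is an abelian scheme, MFK Prop. 6.15). -/
def IsAbelianThreefoldModel (𝒳 : SchemeOver (WittVector p k)) : Prop :=
  IsSmoothProperModel 3 𝒳 ∧ IsProjectiveOverRing 𝒳 ∧ ∃ A : AbelianVariety k, A.X = specialFibre 𝒳

/-- Card A, OUTPUT predicate (first content case of the crux, `d = 3`, abelian): step lifting on every
abelian threefold model, `p ≥ 5`. -/
def FourierRotationOutput (C : CrystallineRealization p k) (Θ : AtiyahTracePackage k) : Prop :=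
  5 ≤ p → ∀ ⦃𝒳 : SchemeOver (WittVector p k)⦄, IsAbelianThreefoldModel 𝒳 → StepLifting C Θ 𝒳

/-- Card A, FIRST LEMMA (shape): for the classical `(C, Θ)`, the RANK-ONE theorem (Berthelot–Ogus 3.8,
tree predicate `BerthelotOgusLineBundleLifting`) already forces the abelian-threefold case — because the
level-wise Fourier–Mukai transform of `𝒳` and its dual rotates `σ₁ ↦ σ₀ = tr ↦ det`. -/
def FourierRotationFirstLemma (C : CrystallineRealization p k) (Θ : AtiyahTracePackage k) : Prop :=
  C.BerthelotOgusLineBundleLifting → FourierRotationOutput C Θ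

omit [Fact p.Prime] [CharP k p] [PerfectRing k p] in
/-- Real numerology behind Card A: on a noetherian special fibre of dimension `< 4` (a threefold) the
targets `H^{q+2}(X, Ω^q)` of `σ_q` vanish for `q ≥ 2`, so p-adic semiregularity (any `p ≥ 2`) is
injectivity of `σ₀ ⊕ σ₁` alone — the two components the Fourier–Mukai transform SWAPS. -/
theorem isPadicSemiregular_iff_of_dim_lt_four (Θ : AtiyahTracePackage k) (X : SchemeOver k)
    [IsNoetherian X.left] (hX : topologicalKrullDim X.left < (4 : ℕ)) (E : X.left.Modules) (hp : 2 ≤ p) :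
    Θ.IsPadicSemiregular p X E ↔
      ∀ x : obstructionGroup 2 E (structureSheafModule X.left),
        Θ.sigma X E 0 x = 0 → Θ.sigma X E 1 x = 0 → x = 0 := by
  constructor
  · intro h x h0 h1
    refine h x fun q hq => ?_
    rcases Nat.lt_or_ge q 2 with hq2 | hq2
    · interval_cases q
      · exact h0
      · exact h1
    · haveI : Subsingleton (hodgeCohomology X q (q + 2)) :=
        subsingleton_hodgeCohomology_of_lt X q (q + 2)
          (lt_of_lt_of_le hX (by exact_mod_cast (by omega : 4 ≤ q + 2)))
      exact Subsingleton.elim _ _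
  · intro h x hx
    exact h x (hx 0 (by omega)) (hx 1 (by omega))

/-! ## Card C — the torsor of thickenings -/

/-- Card C, FIRST LEMMA (real-carrier consequence of "Δ = ισ(o) − δ(ch) does not depend on the lift
`X_{n+2} ⊃ X_{n+1}`"): let `𝒳, 𝒳'` be two smooth projective models with IDENTIFIED `(n+1)`-st
thickenings `e : X_{n+1} ≅ X'_{n+1}` (compatible with the structure maps to `W_{n+1}`, elided), and `F`
finite locally free on `X_{n+1}` restricting to a `Θ`-semiregular `E₁` with the BEK Hodge condition on
`𝒳`; if the transported bundle lifts to `X'_{n+2}` then `F` lifts to `X_{n+2}`. (Joint-lift criterion: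
pairs `(X_{n+1}, F)` that lift SOMEWHERE satisfy P1b♮ for EVERY lift.) -/
def ThickeningTorsorFirstLemma (C : CrystallineRealization p k) (Θ : AtiyahTracePackage k) : Prop :=
  ∀ ⦃d : ℕ⦄ ⦃𝒳 𝒳' : SchemeOver (WittVector p k)⦄, IsSmoothProperModel d 𝒳 → IsSmoothProperModel d 𝒳' →
    IsProjectiveOverRing 𝒳 → d + 2 ≤ p → HodgeTorsionFree p 𝒳 →
    ∀ (n : ℕ) (e : (thickening 𝒳 (n + 1)).left ≅ (thickening 𝒳' (n + 1)).left)
      (E₁ : (specialFibre 𝒳).left.Modules), IsFiniteLocallyFree E₁ →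
      Θ.IsPadicSemiregular p (specialFibre 𝒳) E₁ → C.HodgeCondition 𝒳 E₁ →
      ∀ (F : (thickening 𝒳 (n + 1)).left.Modules), IsFiniteLocallyFree F →
        Nonempty ((Scheme.Modules.pullback (specialFibreToThickening 𝒳 n)).obj F ≅ E₁) →
        LiftsAlong (thickeningMap 𝒳' (Nat.le_succ (n + 1))) ((Scheme.Modules.pullback e.inv).obj F) →
        LiftsAlong (thickeningMap 𝒳 (Nat.le_succ (n + 1))) F

end Witt

end Summit.HodgeConjecture.HodgeConjecture.Cruxes.PadicPridhamSemiregularity.Ideas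

end
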